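import Literature.AlgebraicGeometry.Motives.AbelianVarietyGoodReductionConjugateGeomTorsion
import Literature.AlgebraicGeometry.Motives.AbelianVarietyTorsionPrimaryDecomposition
import HarnessLib

/-!
# «`t^γ = κt`» on the RATIONAL `ℓᵐ`-torsion from the geometric torsion clause, and on the rational `N`-torsion

[Shimura1998] G. Shimura, *Abelian varieties with complex multiplication and modular functions* (1998), §18.6 proof of
Thm. 18.6, p. 128 («`(t^σ)~ = π(t̃) = (κt)~` … hence `t^σ = κt`», «for every rational prime `ℓ` …»; the `ℓ`-adic estimates pp. 128–129); §11.1
Prop. 14, §11.2 Prop. 16.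

Layer `Literature/AlgebraicGeometry/Motives`, namespace
`Literature.AlgebraicGeometry.Motives.AbelianVariety.GoodReductionAt.HomReduction`.  KERNEL ONLY: theorems; no definition,
no instance, no named fact.  DESCENT companion of `Motives/AbelianVarietyGoodReductionConjugateGeomTorsion`
(`map_conjugateBaseChangeAlongIso_baseChange_eq_conjPoints`: «`κ_{K̄} = σ̃`-conjugation on `(A₀ ⊗ K̄)[ℓᵐ](K̄)`»): for a
`K`-RATIONAL torsion point `x ∈ A₀[ℓᵐ](K)` the geometric statement at `x_{K̄}` reads, through the points formula of
`conjugateBaseChangeAlongIso` (`(x_{K̄})^σ̃ = e((x^γ)_{K̄})` for ANY `σ̃ ⊇ γ`) and the naturality `κ_{K̄}(x_{K̄}) = (κx)_{K̄}`,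
as `(κx)_{K̄} = (x^γ)_{K̄}`, hence `κx = x^γ` in `A₀^γ(K)` (injectivity of `A₀^γ(K) → (A₀^γ ⊗ K̄)(K̄)`).  Then the
PRIMARY DECOMPOSITION (`map_eq_conjPoints_of_forall_primePow`) assembles the prime powers `ℓ′ᵐ ∣ N` to `A₀[N](K)`.
This is piece D1 of the S7a level structure (row II-1 of the h21 programme): «`κ = γ` on the `L₁`-rational `N`-torsion».

## Main statements
* `map_eq_conjPoints_of_geomTorsion_clause` — ONE prime `ℓ ≠ char v`, one exponent `m`: the rational `ℓᵐ`-torsion.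
* `map_eq_conjPoints_of_forall_prime` — all of `A₀[N](K)` from the per-prime statements (`ℓ′ ∣ N`).
-/

noncomputable section

open CategoryTheory CategoryTheory.Limits AlgebraicGeometry NumberField IsDedekindDomain

namespace Literature.AlgebraicGeometry.Motives

namespace AbelianVariety

namespace GoodReductionAt

namespace HomReduction

variable {K : Type} [Field K] [NumberField K] {A₀ : AbelianVariety K} {v : HeightOneSpectrum (𝓞 K)}
  {R : A₀.GoodReductionAt v} (γ : K ≃+* K) {Rγ : (A₀.conjugate γ).GoodReductionAt v}
  {p n : ℕ} [ExpChar v.asIdeal.ResidueField p] {ℓ : ℕ} [Fact ℓ.Prime]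
  {TA : R.TateSpecialisation ℓ} {Tγ : Rγ.TateSpecialisation ℓ} {Hγ : HomReduction R Rγ}

/-- **«`t^γ = κt`» for every RATIONAL `ℓᵐ`-torsion point `t ∈ A₀[ℓᵐ](K)`** — descent of the geometric statement
`map_conjugateBaseChangeAlongIso_baseChange_eq_conjPoints` («`κ_{K̄}` is `σ̃`-conjugation on `(A₀ ⊗ K̄)[ℓᵐ](K̄)`», from the
geometric torsion clause of the specialisation data, the Tate compatibility of `Hγ` and `κ̃ ≫ e = F`) to `K`-rational points:
`(κx)_{K̄} = κ_{K̄}(x_{K̄}) = (x_{K̄})^σ̃ = e((x^γ)_{K̄})` read back through `e` and the injections `A₀^γ(K) ↪ A₀^γ(K̄) ≃ (A₀^γ ⊗ K̄)(K̄)`.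
[cite: Shimura1998, §18.6 proof of Thm. 18.6 (p. 128)] [cite: Shimura1998, §11.2 Prop. 16 (p. 86)] -/
theorem map_eq_conjPoints_of_geomTorsion_clause (e : Rγ.reduction ≅ R.reduction.frobeniusTwist p n)
    (hH : Hγ.IsTateCompatible TA Tγ) (hℓv : (ℓ : 𝓞 K) ∉ v.asIdeal)
    (σ : AlgebraicClosure K ≃+* AlgebraicClosure K)
    (hσ : ∀ a, σ (algebraMap K (AlgebraicClosure K) a) = algebraMap K (AlgebraicClosure K) (γ a)) (m : ℕ)
    (hclause : ∀ (x : A₀.geomTorsion (ℓ ^ m : ℕ)) (x' : (A₀.conjugate γ).geomTorsion (ℓ ^ m : ℕ)),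
      Additive.toMul (x' : (A₀.conjugate γ).geomPoints) =
        ((A₀.conjugate γ).pointsMulEquiv (AlgebraicClosure K)).symm
          (AlgPoints.map (conjugateBaseChangeAlongIso γ σ hσ A₀).inv.hom.hom.hom
            ((A₀.baseChange (AlgebraicClosure K)).conjPoints σ
              (A₀.pointsMulEquiv (AlgebraicClosure K) (Additive.toMul (x : A₀.geomPoints))))) →
      (Tγ.reductionTorsionEquiv hℓv m x' : Rγ.reduction.geomPoints) =
        Hom.geomPointsMap e.inv (Hom.geomPointsMap (R.reduction.relFrobenius p n)
          (TA.reductionTorsionEquiv hℓv m x : R.reduction.geomPoints)))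
    (κ : A₀ ⟶ A₀.conjugate γ) (hκ : Hγ.redHom κ ≫ e.hom = R.reduction.relFrobenius p n)
    (x : A₀.Points K) (hx : x ∈ A₀.torsionPoints K ((ℓ ^ m : ℕ) : ℤ)) :
    AlgPoints.map κ.hom.hom.hom x = A₀.conjPoints γ x := by
  -- the `K̄`-point `y = x_{K̄}` of `A₀ ⊗ K̄`, again `ℓᵐ`-torsion
  set y : (A₀.baseChange (AlgebraicClosure K)).Points (AlgebraicClosure K) :=
    A₀.pointsMulEquiv (AlgebraicClosure K) (AlgPoints.extendScalars A₀.X K (AlgebraicClosure K) x) with hy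
  have hyφ : y = ((A₀.pointsMulEquiv (AlgebraicClosure K)).toMonoidHom.comp
      (AlgPoints.extendScalarsMonoidHom A₀.X K (AlgebraicClosure K))) x := rfl
  have hy_tors : y ∈ (A₀.baseChange (AlgebraicClosure K)).torsionPoints (AlgebraicClosure K) ((ℓ ^ m : ℕ) : ℤ) := by
    rw [mem_torsionPoints_iff] at hx ⊢
    rw [hyφ, ← map_zpow, hx, map_one]
  -- (A) the geometric statement at `y`
  have hA := map_conjugateBaseChangeAlongIso_baseChange_eq_conjPoints γ e hH hℓv σ hσ m hclause κ hκ ⟨y, hy_tors⟩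
  -- (B) the points formula at the rational point `x`
  have hB := map_conjugateBaseChangeAlongIso_hom_pointsMulEquiv_extendScalars_conjPoints γ σ hσ A₀ x
  -- (C) naturality `κ_{K̄}(x_{K̄}) = (κx)_{K̄}`
  have hC : AlgPoints.map (Hom.baseChange (AlgebraicClosure K) κ).hom.hom.hom y =
      (A₀.conjugate γ).pointsMulEquiv (AlgebraicClosure K)
        (AlgPoints.extendScalars (A₀.conjugate γ).X K (AlgebraicClosure K) (AlgPoints.map κ.hom.hom.hom x)) := by
    rw [hy, ← pointsMulEquiv_map]
    rfl
  -- combine: `e((κx)_{K̄}) = y^σ̃ = e((x^γ)_{K̄})`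
  have hD : AlgPoints.map (conjugateBaseChangeAlongIso γ σ hσ A₀).hom.hom.hom.hom
        ((A₀.conjugate γ).pointsMulEquiv (AlgebraicClosure K)
          (AlgPoints.extendScalars (A₀.conjugate γ).X K (AlgebraicClosure K) (AlgPoints.map κ.hom.hom.hom x))) =
      AlgPoints.map (conjugateBaseChangeAlongIso γ σ hσ A₀).hom.hom.hom.hom
        ((A₀.conjugate γ).pointsMulEquiv (AlgebraicClosure K)
          (AlgPoints.extendScalars (A₀.conjugate γ).X K (AlgebraicClosure K) (A₀.conjPoints γ x))) := by
    rw [← hC, hB]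
    exact hA
  -- cancel the isomorphism and the two injections
  have hE := congrArg (AlgPoints.map (conjugateBaseChangeAlongIso γ σ hσ A₀).inv.hom.hom.hom) hD
  have hinv : ∀ Q : ((A₀.conjugate γ).baseChange (AlgebraicClosure K)).Points (AlgebraicClosure K),
      AlgPoints.map (conjugateBaseChangeAlongIso γ σ hσ A₀).inv.hom.hom.hom
        (AlgPoints.map (conjugateBaseChangeAlongIso γ σ hσ A₀).hom.hom.hom.hom Q) = Q :=
    fun Q => map_hom_map_inv_points (conjugateBaseChangeAlongIso γ σ hσ A₀).symm Q
  rw [hinv, hinv] at hE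
  exact AlgPoints.extendScalars_injective (X := (A₀.conjugate γ).X) (L := K) (L' := AlgebraicClosure K)
    (((A₀.conjugate γ).pointsMulEquiv (AlgebraicClosure K)).injective hE)

omit [NumberField K] in
/-- **«`t^γ = κt`» on all of `A₀[N](K)` from the primes `ℓ′ ∣ N`**: if for every prime `ℓ′ ∣ N` and every `m` the rational
`ℓ′ᵐ`-torsion satisfies `κx = x^γ` (one instance of `map_eq_conjPoints_of_geomTorsion_clause` per prime, at a place
`v ∤ ℓ′`), then so does the `N`-torsion (`N ≠ 0`; primary decomposition `map_eq_conjPoints_of_forall_primePow`).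
[cite: Shimura1998, §18.6 proof of Thm. 18.6, pp. 128–129 («t^σ = κt» and «for every rational prime ℓ» p. 128; the ℓ-adic estimates pp. 128–129)] [cite: MumfordAV1970, §4] -/
theorem map_eq_conjPoints_of_forall_prime (κ : A₀ ⟶ A₀.conjugate γ) {N : ℕ} (hN : N ≠ 0)
    (h : ∀ ℓ' : ℕ, ℓ'.Prime → ℓ' ∣ N → ∀ (m : ℕ) (x : A₀.Points K),
      x ∈ A₀.torsionPoints K ((ℓ' ^ m : ℕ) : ℤ) → AlgPoints.map κ.hom.hom.hom x = A₀.conjPoints γ x) :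
    ∀ x : A₀.Points K, x ∈ A₀.torsionPoints K (N : ℤ) → AlgPoints.map κ.hom.hom.hom x = A₀.conjPoints γ x :=
  map_eq_conjPoints_of_forall_primePow A₀ γ κ hN fun ℓ' m hℓ' hm hdvd =>
    h ℓ' hℓ' (Nat.dvd_of_pow_dvd hm hdvd) m

end HomReduction

end GoodReductionAt

end AbelianVariety

end Literature.AlgebraicGeometry.Motives

end
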